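import Summits.CriticalPhenomena.PercolationContinuityZ3.Theorems.PercNearOneGluingNoHeavyLowerTailFKSetClusterTreeHarris
import Summits.CriticalPhenomena.PercolationContinuityZ3.Theorems.PercNearOneGluingNoHeavyLowerTailFKHullPortPvTools
import HarnessLib

/-!
# FK sub-lane: tools for Lemma (★^H) for `φ_{𝐩,q}` (classes of `C_N`, world = conditional covariance, vdBHK 1.4 with a set)

Support file (`--supports stmt-CriticalPhenomena-4575`), FK sub-lane `prim-bschramm-fk-2` (gen 3); builds on p205010 (kernel theorem,
internal audit signed; external expert review pending).  No definitions, no named facts, no sorries; standard axioms.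

Ingredients of hp-8's one-source bound (★^H) ((K7) of PROOF-S5-ALL-R; the base input of Lemma `Δ_N^S` / `T^S ≥ 0`,
bschramm/FK-Q2.md §12.6(c)) for the random-cluster measure `φ = rcMeasureW u q ∅`, in the language of the classes
`E_ω = {C_N = C_N(ω)}` of the open edge cluster `C_N = ⋃_{n∈N} C_n` of a vertex set:
* `FK.reachable_iff_of_setCl_eq_of_joined`, `FK.openEdgeCluster_eq_of_setCl_eq_of_joined` — on a class, the clusters of the
  vertices joined to `N` are decided;
* `FK.openEdgeCluster_setCl_eq` — `C_x(C_S) = C_x` for `x ∈ S` (to read a `C_x`-event as an increasing function of `C_S`);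
* `FK.sum_rcMass_mul_condProb_key` — reindexing over the classes of any key: `E[h · φ(B | σ(κ))] = E[h 1_B]`;
* `FK.starH_world_eq` — on `{x, v ∉ N ∪ V(C_N)}` the world covariance `Cov_{φ_{u − C̄_N(ω)}}(1_U(C_x), 1{S ↔ v})` is the conditional
  covariance given the class (vdBHK Lemma 2.3 for `φ_{𝐩,q}`);
* `FK.real_clusterEvent_setReach_mul_le` — vdBHK Thm 1.4 with the vertex SET `S` for `φ_{𝐩,q}`
  (`BHK2006_twoSetConditionalAssociation_rc_negCorrelation`): given `{S ↮ v}`, `{C_x ∈ U}` (`x ∈ S`, increasing in `C_S`) and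
  `{N ↔ v}` (increasing in `C_v`) are negatively correlated.
[cite: VandenbergHaggstromKahn2005, Thm. 1.4 (p. 7), Thm. 2.1 (p. 9), §2.1 Lemmas 2.3–2.4 (p. 10)] [cite: Grimmett2006, Thm. (3.8)(b) (p. 39)]
[cite: Gladkov2024, §2]
-/

noncomputable section

namespace Summit.CriticalPhenomena.PercolationContinuityZ3.Theorems.FK

open MeasureTheory Set
open Literature.Probability.LatticeModels Literature.Probability.Percolation
open Literature.Probability.Percolation.DecisionTree (ind ind_of_mem ind_of_not_mem ind_nonneg)
open Literature.Probability.Percolation.BHK2006 (rcMass rcMass_nonneg sum_rcMass delW setCl barOf mem_setCl_iff setCl_subset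
  setReach_iff rcMeasureW_real_eq_sum_rcMass setCl_eq_sdiff_barOf openEdgeCluster_mono ind_inter setCl_mono
  setIntegral_rcMeasureW_eq_sum)
open Literature.Probability.Percolation.KNPreFKG
open Summit.CriticalPhenomena.PercolationContinuityZ3.Theorems.HullPort (cut avoidEv cut_eq_barOf)
open scoped Classical

variable {V : Type*} [Fintype V]

/-! ### On a class of `C_N`, the clusters of the vertices joined to `N` are decided -/

omit [Fintype V] in
/-- If `C_N(ζ) = C_N(ω)` and `a` is joined to `N` in `ω`, then `a` is joined to the same vertices in `ζ` and in `ω` (open paths from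
`a` run inside `C_N`). [cite: VandenbergHaggstromKahn2005, §1 p. 3, §2.1 p. 9] -/
theorem reachable_iff_of_setCl_eq_of_joined {ζ ω : BondConfig V} {N : Set V} (h : setCl ζ N = setCl ω N) {a : V}
    (ha : ∃ n ∈ N, (openGraph ω).Reachable n a) (z : V) :
    (openGraph ζ).Reachable a z ↔ (openGraph ω).Reachable a z := by
  -- paths from a vertex joined to `N` use only edges of `C_N`
  have key : ∀ {ξ ξ' : BondConfig V}, setCl ξ N = setCl ξ' N → (∃ n ∈ N, (openGraph ξ).Reachable n a) →
      ∀ z, (openGraph ξ).Reachable a z → (openGraph ξ').Reachable a z := by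
    intro ξ ξ' hξ han z haz
    rw [SimpleGraph.reachable_iff_reflTransGen] at haz
    induction haz with
    | refl => exact SimpleGraph.Reachable.refl a
    | @tail b c hab hbc ih =>
      obtain ⟨hbc', hne⟩ := (openGraph_adj ξ b c).1 hbc
      have hb : ∃ n ∈ N, (openGraph ξ).Reachable n b := by
        obtain ⟨n, hn, hna⟩ := han
        exact ⟨n, hn, hna.trans ((SimpleGraph.reachable_iff_reflTransGen _ _).2 hab)⟩
      have hmem : s(b, c) ∈ setCl ξ N := by
        obtain ⟨n, hn, hnb⟩ := hb
        exact (mem_setCl_iff_exists_reachable ξ N _).2 ⟨hbc', by rwa [Sym2.mk_isDiag_iff], b, Sym2.mem_mk_left _ _, n, hn, hnb⟩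
      rw [hξ] at hmem
      exact ih.trans (SimpleGraph.Adj.reachable ((openGraph_adj ξ' b c).2 ⟨setCl_subset ξ' N hmem, hne⟩))
  have ha' : ∃ n ∈ N, (openGraph ζ).Reachable n a := (setReachable_iff_of_setCl_eq h a).2 ha
  exact ⟨key h ha' z, key h.symm ha z⟩

omit [Fintype V] in
/-- If `C_N(ζ) = C_N(ω)` and `a` is joined to `N` in `ω`, then `C_a(ζ) = C_a(ω)`. [cite: VandenbergHaggstromKahn2005, §1 p. 3, §2.1 p. 9] -/
theorem openEdgeCluster_eq_of_setCl_eq_of_joined {ζ ω : BondConfig V} {N : Set V} (h : setCl ζ N = setCl ω N) {a : V}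
    (ha : ∃ n ∈ N, (openGraph ω).Reachable n a) : openEdgeCluster ζ a = openEdgeCluster ω a := by
  have hr := reachable_iff_of_setCl_eq_of_joined h ha
  have ha' : ∃ n ∈ N, (openGraph ζ).Reachable n a := (setReachable_iff_of_setCl_eq h a).2 ha
  ext e
  rw [mem_openEdgeCluster_iff, mem_openEdgeCluster_iff]
  constructor
  · rintro ⟨he, hd, hre⟩
    have hre' : ∀ z ∈ e, (openGraph ω).Reachable a z := fun z hz => (hr z).1 (hre z hz)
    refine ⟨?_, hd, hre'⟩
    induction e using Sym2.ind with
    | h b c =>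
      have hmem : s(b, c) ∈ setCl ζ N := by
        obtain ⟨n, hn, hna⟩ := ha'
        exact (mem_setCl_iff_exists_reachable ζ N _).2
          ⟨he, hd, b, Sym2.mem_mk_left _ _, n, hn, hna.trans (hre b (Sym2.mem_mk_left _ _))⟩
      rw [h] at hmem
      exact setCl_subset ω N hmem
  · rintro ⟨he, hd, hre⟩
    have hre' : ∀ z ∈ e, (openGraph ζ).Reachable a z := fun z hz => (hr z).2 (hre z hz)
    refine ⟨?_, hd, hre'⟩
    induction e using Sym2.ind with
    | h b c =>
      have hmem : s(b, c) ∈ setCl ω N := by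
        obtain ⟨n, hn, hna⟩ := ha
        exact (mem_setCl_iff_exists_reachable ω N _).2
          ⟨he, hd, b, Sym2.mem_mk_left _ _, n, hn, hna.trans (hre b (Sym2.mem_mk_left _ _))⟩
      rw [← h] at hmem
      exact setCl_subset ζ N hmem

omit [Fintype V] in
/-- **`C_x(C_S) = C_x` for `x ∈ S`**: the open edge cluster of `x` computed inside the configuration `C_S` is the open edge cluster
of `x` (so a `C_x`-event is a function of `C_S`). [cite: VandenbergHaggstromKahn2005, §2.1 p. 9 (`C_S`)] -/
theorem openEdgeCluster_setCl_eq (ω : BondConfig V) {S : Set V} {x : V} (hx : x ∈ S) :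
    openEdgeCluster (setCl ω S) x = openEdgeCluster ω x := by
  -- reachability from `x` is the same in `C_S` and in `ω`
  have hreach : ∀ z, (openGraph (setCl ω S)).Reachable x z ↔ (openGraph ω).Reachable x z := by
    intro z
    constructor
    · exact fun h => h.mono (openGraph_mono (setCl_subset ω S))
    · intro h
      rw [SimpleGraph.reachable_iff_reflTransGen] at h
      induction h with
      | refl => exact SimpleGraph.Reachable.refl x
      | @tail b c hxb hbc ih =>
        obtain ⟨hbc', hne⟩ := (openGraph_adj ω b c).1 hbc
        have hmem : s(b, c) ∈ setCl ω S :=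
          (mem_setCl_iff_exists_reachable ω S _).2 ⟨hbc', by rwa [Sym2.mk_isDiag_iff], b, Sym2.mem_mk_left _ _, x, hx,
            (SimpleGraph.reachable_iff_reflTransGen _ _).2 hxb⟩
        exact ih.trans (SimpleGraph.Adj.reachable ((openGraph_adj (setCl ω S) b c).2 ⟨hmem, hne⟩))
  ext e
  rw [mem_openEdgeCluster_iff, mem_openEdgeCluster_iff]
  constructor
  · rintro ⟨he, hd, hre⟩
    exact ⟨setCl_subset ω S he, hd, fun z hz => (hreach z).1 (hre z hz)⟩
  · rintro ⟨he, hd, hre⟩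
    refine ⟨?_, hd, fun z hz => (hreach z).2 (hre z hz)⟩
    induction e using Sym2.ind with
    | h b c =>
      exact (mem_setCl_iff_exists_reachable ω S _).2
        ⟨he, hd, b, Sym2.mem_mk_left _ _, x, hx, hre b (Sym2.mem_mk_left _ _)⟩

/-! ### Reindexing over the classes of a key -/

/-- **Reindexing over the classes of a key `κ`**: for `h` constant on the classes `{κ = κ(ω)}`,
`Σ_ω φ{ω} h(ω) φ(B ∩ E_ω)/φ(E_ω) = φ-mass of `h·1_B``, i.e. `E[h · φ(B | σ(κ))] = E[h 1_B]`. [folklore] -/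
theorem sum_rcMass_mul_condProb_key {β : Type*} (w : Sym2 V → unitInterval) {q : ℝ} (hq : 0 < q) (κ : BondConfig V → β)
    (B : Set (BondConfig V)) (h : BondConfig V → ℝ) (hh : ∀ ω ω' : BondConfig V, κ ω' = κ ω → h ω' = h ω) :
    ∑ ω, rcMass w q ω * (h ω * ((rcMeasureW w q ∅).real (B ∩ {ζ | κ ζ = κ ω}) / (rcMeasureW w q ∅).real {ζ | κ ζ = κ ω})) =
      ∑ ω, rcMass w q ω * (h ω * ind B ω) := by
  classical
  set E : BondConfig V → Set (BondConfig V) := fun ω => {ζ | κ ζ = κ ω} with hE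
  have hEsymm : ∀ ω ω', ω' ∈ E ω → ω ∈ E ω' := fun ω ω' h' => by
    simp only [hE, Set.mem_setOf_eq] at h' ⊢; exact h'.symm
  have hEeq : ∀ ω ω', ω' ∈ E ω → E ω' = E ω := fun ω ω' h' => by
    have h'' : κ ω' = κ ω := h'
    ext ζ; simp only [hE, Set.mem_setOf_eq, h'']
  have hB : ∀ ω, (rcMeasureW w q ∅).real (B ∩ E ω) = ∑ ω', rcMass w q ω' * (ind B ω' * ind (E ω) ω') := by
    intro ω
    rw [rcMeasureW_real_eq_sum_rcMass w hq]
    refine Finset.sum_congr rfl fun ω' _ => ?_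
    rw [ind_inter]
  have hEmass : ∀ ω, (rcMeasureW w q ∅).real (E ω) = ∑ ω', rcMass w q ω' * ind (E ω) ω' := fun ω =>
    rcMeasureW_real_eq_sum_rcMass w hq _
  have hzero : ∀ ω, (rcMeasureW w q ∅).real (E ω) = 0 → rcMass w q ω = 0 := by
    intro ω h0
    have hle : rcMass w q ω * ind (E ω) ω ≤ ∑ ω', rcMass w q ω' * ind (E ω) ω' :=
      Finset.single_le_sum (f := fun ω' => rcMass w q ω' * ind (E ω) ω')
        (fun ω' _ => mul_nonneg (rcMass_nonneg w hq ω') (ind_nonneg _ _)) (Finset.mem_univ ω)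
    rw [← hEmass, h0, ind_of_mem (show ω ∈ E ω from rfl), mul_one] at hle
    exact le_antisymm hle (rcMass_nonneg w hq ω)
  calc ∑ ω, rcMass w q ω * (h ω * ((rcMeasureW w q ∅).real (B ∩ E ω) / (rcMeasureW w q ∅).real (E ω)))
      = ∑ ω, ∑ ω', rcMass w q ω * h ω / (rcMeasureW w q ∅).real (E ω) * (rcMass w q ω' * (ind B ω' * ind (E ω) ω')) := by
        refine Finset.sum_congr rfl fun ω _ => ?_
        rw [hB ω]
        simp only [div_eq_mul_inv, Finset.sum_mul, Finset.mul_sum]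
        refine Finset.sum_congr rfl fun ω' _ => ?_
        ring
    _ = ∑ ω', ∑ ω, rcMass w q ω * h ω / (rcMeasureW w q ∅).real (E ω) * (rcMass w q ω' * (ind B ω' * ind (E ω) ω')) :=
        Finset.sum_comm
    _ = ∑ ω', rcMass w q ω' * (h ω' * ind B ω') := by
        refine Finset.sum_congr rfl fun ω' _ => ?_
        have hterm : ∀ ω, rcMass w q ω * h ω / (rcMeasureW w q ∅).real (E ω) * (rcMass w q ω' * (ind B ω' * ind (E ω) ω')) =
            rcMass w q ω' * (h ω' * ind B ω') / (rcMeasureW w q ∅).real (E ω') * (rcMass w q ω * ind (E ω') ω) := by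
          intro ω
          by_cases hm : ω' ∈ E ω
          · have h1' : h ω' = h ω := hh ω ω' hm
            rw [ind_of_mem hm, ind_of_mem (hEsymm ω ω' hm), hEeq ω ω' hm, h1']
            ring
          · have hm' : ω ∉ E ω' := fun h' => hm (hEsymm ω' ω h')
            rw [ind_of_not_mem hm, ind_of_not_mem hm']
            ring
        simp only [hterm, ← Finset.mul_sum]
        rw [← hEmass ω']
        by_cases h0 : (rcMeasureW w q ∅).real (E ω') = 0
        · rw [hzero ω' h0]; simp
        · field_simp

/-! ### The world covariance on `{x, v ∉ N ∪ V(C_N)}` is the class-conditional covariance -/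

/-- **World covariance = class-conditional covariance along `σ(C_N)` (vdBHK Lemma 2.3 for `φ_{𝐩,q}`).**  If neither `x` nor `v` is
joined to `N` in `ω` (and `ω` has positive mass), then with `W = C_N(ω)`, `A = {C_x ∈ U}`, `Y = {S ↔ v}` and the class
`E_ω = {C_N = W}`:  `Cov_{φ_{u − W̄}}(1_U(C_x), 1{S ↔ v}) = φ(A ∩ Y | E_ω) − φ(A | E_ω)·φ(Y | E_ω)`.
[cite: VandenbergHaggstromKahn2005, §2.1 Lemma 2.3 (p. 10)] [cite: Grimmett2006, Thm. (3.8)] -/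
theorem starH_world_eq (u : Sym2 V → unitInterval) {q : ℝ} (hq : 0 < q) (x v : V) (S N : Set V)
    (U : Set (Set (Sym2 V))) {ω : BondConfig V} (hx : ∀ n ∈ N, ¬ (openGraph ω).Reachable n x)
    (hv : ∀ n ∈ N, ¬ (openGraph ω).Reachable n v) (hne : rcMass u q ω ≠ 0) :
    (∑ η, rcMass (delW u (cut N ω)) q η * (U.indicator (1 : Set (Sym2 V) → ℝ) (openEdgeCluster η x) *
        ind {ζ : BondConfig V | ∃ s ∈ S, (openGraph ζ).Reachable s v} η)) -
      (∑ η, rcMass (delW u (cut N ω)) q η * U.indicator (1 : Set (Sym2 V) → ℝ) (openEdgeCluster η x)) *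
        (∑ η, rcMass (delW u (cut N ω)) q η * ind {ζ : BondConfig V | ∃ s ∈ S, (openGraph ζ).Reachable s v} η) =
      (rcMeasureW u q ∅).real (({η : BondConfig V | openEdgeCluster η x ∈ U} ∩
            {ζ : BondConfig V | ∃ s ∈ S, (openGraph ζ).Reachable s v}) ∩ {ζ : BondConfig V | setCl ζ N = setCl ω N}) /
          (rcMeasureW u q ∅).real {ζ : BondConfig V | setCl ζ N = setCl ω N} -
        (rcMeasureW u q ∅).real ({η : BondConfig V | openEdgeCluster η x ∈ U} ∩ {ζ : BondConfig V | setCl ζ N = setCl ω N}) /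
            (rcMeasureW u q ∅).real {ζ : BondConfig V | setCl ζ N = setCl ω N} *
          ((rcMeasureW u q ∅).real ({ζ : BondConfig V | ∃ s ∈ S, (openGraph ζ).Reachable s v} ∩
                {ζ : BondConfig V | setCl ζ N = setCl ω N}) /
            (rcMeasureW u q ∅).real {ζ : BondConfig V | setCl ζ N = setCl ω N}) := by
  classical
  haveI := isProbabilityMeasure_rcMeasureW u hq (∅ : Set V)
  -- positivity of the class
  have hEp : 0 < (rcMeasureW u q ∅).real {ζ : BondConfig V | setCl ζ N = setCl ω N} := by
    have hmass : (rcMeasureW u q ∅).real {ω} = rcMass u q ω := by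
      rw [rcMeasureW_real_singleton u hq]; rfl
    have hle : (rcMeasureW u q ∅).real {ω} ≤ (rcMeasureW u q ∅).real {ζ : BondConfig V | setCl ζ N = setCl ω N} :=
      measureReal_mono (Set.singleton_subset_iff.2 rfl) (measure_ne_top _ _)
    rw [hmass] at hle
    exact lt_of_lt_of_le (lt_of_le_of_ne (rcMass_nonneg u hq ω) (Ne.symm hne)) hle
  set A : Set (BondConfig V) := {η : BondConfig V | openEdgeCluster η x ∈ U} with hA
  set Y : Set (BondConfig V) := {ζ : BondConfig V | ∃ s ∈ S, (openGraph ζ).Reachable s v} with hY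
  set Eω : Set (BondConfig V) := {ζ : BondConfig V | setCl ζ N = setCl ω N} with hE
  have hgA : ∀ η : BondConfig V, U.indicator (1 : Set (Sym2 V) → ℝ) (openEdgeCluster η x) = ind A η :=
    indicator_one_openEdgeCluster U x
  set W := setCl ω N with hW
  have hcut : cut N ω = barOf N W := by rw [cut_eq_barOf]
  have hEv : {ζ : BondConfig V | (⋃ s' ∈ N, openEdgeCluster ζ s') = W} = Eω := by
    ext ζ; simp only [hE, Set.mem_setOf_eq]; rfl
  -- `x` and `v` are not in `N ∪ V(W)`
  have hxW : ∀ t ∈ ({x} : Set V), ¬ (t ∈ N ∨ ∃ e ∈ W, t ∈ e) := by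
    intro t ht; rw [Set.mem_singleton_iff] at ht; subst ht
    rw [hW, ← setReach_iff]; rintro ⟨n, hn, h⟩; exact hx n hn h
  have hvW : ∀ t ∈ ({v} : Set V), ¬ (t ∈ N ∨ ∃ e ∈ W, t ∈ e) := by
    intro t ht; rw [Set.mem_singleton_iff] at ht; subst ht
    rw [hW, ← setReach_iff]; rintro ⟨n, hn, h⟩; exact hv n hn h
  -- on the class, `C_x(ζ) = C_x(ζ ∖ W̄)` and `C_v(ζ) = C_v(ζ ∖ W̄)`
  have hCx : ∀ ζ, ζ ∈ Eω → openEdgeCluster ζ x = openEdgeCluster (ζ \ barOf N W) x := by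
    intro ζ hζ
    have hζ' : setCl ζ N = W := hζ
    have := setCl_eq_sdiff_barOf (T := {x}) hζ' hxW
    simpa [setCl] using this
  have hCv : ∀ ζ, ζ ∈ Eω → openEdgeCluster ζ v = openEdgeCluster (ζ \ barOf N W) v := by
    intro ζ hζ
    have hζ' : setCl ζ N = W := hζ
    have := setCl_eq_sdiff_barOf (T := {v}) hζ' hvW
    simpa [setCl] using this
  have hAeq : ∀ ζ, ζ ∈ Eω → (ζ ∈ A ↔ ζ \ barOf N W ∈ A) := by
    intro ζ hζ; simp only [hA, Set.mem_setOf_eq, hCx ζ hζ]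
  have hYeq : ∀ ζ, ζ ∈ Eω → (ζ ∈ Y ↔ ζ \ barOf N W ∈ Y) := by
    intro ζ hζ
    simp only [hY, Set.mem_setOf_eq]
    constructor
    · rintro ⟨s, hs, hsv⟩
      refine ⟨s, hs, ?_⟩
      have h1 := (reachable_iff_exists_mem_openEdgeCluster ζ v s).1 hsv.symm
      rw [hCv ζ hζ] at h1
      exact ((reachable_iff_exists_mem_openEdgeCluster _ v s).2 h1).symm
    · rintro ⟨s, hs, hsv⟩
      refine ⟨s, hs, ?_⟩
      have h1 := (reachable_iff_exists_mem_openEdgeCluster _ v s).1 hsv.symm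
      rw [← hCv ζ hζ] at h1
      exact ((reachable_iff_exists_mem_openEdgeCluster ζ v s).2 h1).symm
  -- world probabilities via Lemma 2.3
  have hker : ∀ (T : Set (BondConfig V)), (∀ ζ, ζ ∈ Eω → (ζ ∈ T ↔ ζ \ barOf N W ∈ T)) →
      (rcMeasureW (delW u (barOf N W)) q ∅).real T = (rcMeasureW u q ∅).real (T ∩ Eω) / (rcMeasureW u q ∅).real Eω := by
    intro T hT
    have h23 := BHK2006_rcMeasureW_real_setCl_inter u hq N W T
    rw [hEv] at h23
    have hset : Eω ∩ {ζ | ζ \ barOf N W ∈ T} = T ∩ Eω := by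
      ext ζ; constructor
      · rintro ⟨h1, h2⟩; exact ⟨(hT ζ h1).2 h2, h1⟩
      · rintro ⟨h1, h2⟩; exact ⟨h2, (hT ζ h2).1 h1⟩
    rw [hset] at h23
    rw [h23]; field_simp
  have hAY : ∀ ζ, ζ ∈ Eω → (ζ ∈ A ∩ Y ↔ ζ \ barOf N W ∈ A ∩ Y) := fun ζ hζ => by
    rw [Set.mem_inter_iff, Set.mem_inter_iff, hAeq ζ hζ, hYeq ζ hζ]
  rw [hcut]
  have w1 : ∑ η, rcMass (delW u (barOf N W)) q η * (U.indicator (1 : Set (Sym2 V) → ℝ) (openEdgeCluster η x) * ind Y η) =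
      (rcMeasureW (delW u (barOf N W)) q ∅).real (A ∩ Y) := by
    rw [rcMeasureW_real_eq_sum_rcMass _ hq]
    refine Finset.sum_congr rfl fun η _ => ?_
    simp only [hgA, ind_inter]
  have w2 : ∑ η, rcMass (delW u (barOf N W)) q η * U.indicator (1 : Set (Sym2 V) → ℝ) (openEdgeCluster η x) =
      (rcMeasureW (delW u (barOf N W)) q ∅).real A := by
    rw [rcMeasureW_real_eq_sum_rcMass _ hq]
    refine Finset.sum_congr rfl fun η _ => ?_; simp only [hgA]
  have w3 : ∑ η, rcMass (delW u (barOf N W)) q η * ind Y η = (rcMeasureW (delW u (barOf N W)) q ∅).real Y := by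
    rw [rcMeasureW_real_eq_sum_rcMass _ hq]
  rw [w1, w2, w3, hker (A ∩ Y) hAY, hker A hAeq, hker Y hYeq]

/-! ### vdBHK Theorem 1.4 with the set `S`: `{C_x ∈ U}` and `{N ↔ v}` are negatively correlated given `{S ↮ v}` -/

/-- **Negative correlation of the owner's cluster event and `{N ↔ v}` given `{S ↮ v}`** (vdBHK Thm 1.4 with the vertex set `S`,
for `φ_{𝐩,q}`, `q ≥ 1`): for `x ∈ S` and an increasing family `U`,
`φ(C_x ∈ U, N ↔ v, S ↮ v) · φ(S ↮ v) ≤ φ(N ↔ v, S ↮ v) · φ(C_x ∈ U, S ↮ v)`.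
[cite: VandenbergHaggstromKahn2005, Thm. 1.4 (p. 7), Thm. 2.1 (p. 9)] [cite: Grimmett2006, Thm. (3.8)(b)] -/
theorem real_clusterEvent_setReach_mul_le (u : Sym2 V → unitInterval) {q : ℝ} (hq : 1 ≤ q) {x : V} (v : V) {S : Set V}
    (hxS : x ∈ S) (N : Set V) (U : Set (Set (Sym2 V))) (hU : IsUpperSet U) :
    (rcMeasureW u q ∅).real ({ω : BondConfig V | openEdgeCluster ω x ∈ U} ∩
          ({ζ : BondConfig V | ∃ n ∈ N, (openGraph ζ).Reachable n v} ∩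
            {ζ : BondConfig V | ∃ s ∈ S, (openGraph ζ).Reachable s v}ᶜ)) *
        (rcMeasureW u q ∅).real {ζ : BondConfig V | ∃ s ∈ S, (openGraph ζ).Reachable s v}ᶜ ≤
      (rcMeasureW u q ∅).real ({ζ : BondConfig V | ∃ n ∈ N, (openGraph ζ).Reachable n v} ∩
          {ζ : BondConfig V | ∃ s ∈ S, (openGraph ζ).Reachable s v}ᶜ) *
        (rcMeasureW u q ∅).real ({ω : BondConfig V | openEdgeCluster ω x ∈ U} ∩
          {ζ : BondConfig V | ∃ s ∈ S, (openGraph ζ).Reachable s v}ᶜ) := by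
  classical
  have hq0 : 0 < q := one_pos.trans_le hq
  set A : Set (BondConfig V) := {ω : BondConfig V | openEdgeCluster ω x ∈ U} with hA
  set Y : Set (BondConfig V) := {ζ : BondConfig V | ∃ s ∈ S, (openGraph ζ).Reachable s v} with hY
  set Nv : Set (BondConfig V) := {ζ : BondConfig V | ∃ n ∈ N, (openGraph ζ).Reachable n v} with hNv
  -- the two test functions
  set Fψ : Set (Sym2 V) → ℝ := fun W => U.indicator (1 : Set (Sym2 V) → ℝ) (openEdgeCluster W x) with hFψ
  set Gψ : Set (Sym2 V) → ℝ := fun C => ind {C : Set (Sym2 V) | ∃ n ∈ N, n = v ∨ ∃ e ∈ C, n ∈ e} C with hGψ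
  have hFm : Monotone Fψ := fun W W' hWW' =>
    monotone_indicator_one_of_isUpperSet hU (openEdgeCluster_mono hWW' x)
  have hGm : Monotone Gψ := by
    refine monotone_ind_of_isUpperSet ?_
    rintro C C' hCC' ⟨n, hn, h⟩
    exact ⟨n, hn, h.imp id fun ⟨e, he, hne⟩ => ⟨e, hCC' he, hne⟩⟩
  have hD : {ω : BondConfig V | ∀ s ∈ S, ∀ t ∈ ({v} : Set V), ¬ (openGraph ω).Reachable s t} = Yᶜ := by
    ext ω; simp only [hY, Set.mem_setOf_eq, Set.mem_singleton_iff, forall_eq, Set.mem_compl_iff, not_exists, not_and]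
  have key := BHK2006_twoSetConditionalAssociation_rc_negCorrelation u hq S ({v} : Set V) Fψ Gψ hFm hGm
  rw [hD] at key
  simp only [Set.mem_singleton_iff, Set.iUnion_iUnion_eq_left] at key
  -- identify the integrands
  have hF : ∀ ω : BondConfig V, Fψ (⋃ s ∈ S, openEdgeCluster ω s) = ind A ω := by
    intro ω
    have h1 : (⋃ s ∈ S, openEdgeCluster ω s) = setCl ω S := rfl
    simp only [hFψ]
    rw [h1, openEdgeCluster_setCl_eq ω hxS, indicator_one_openEdgeCluster U x]
  have hG : ∀ ω : BondConfig V, Gψ (openEdgeCluster ω v) = ind Nv ω := by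
    intro ω
    have hiff : openEdgeCluster ω v ∈ {C : Set (Sym2 V) | ∃ n ∈ N, n = v ∨ ∃ e ∈ C, n ∈ e} ↔ ω ∈ Nv := by
      simp only [hNv, Set.mem_setOf_eq]
      constructor
      · rintro ⟨n, hn, h⟩; exact ⟨n, hn, ((reachable_iff_exists_mem_openEdgeCluster ω v n).2 h).symm⟩
      · rintro ⟨n, hn, h⟩; exact ⟨n, hn, (reachable_iff_exists_mem_openEdgeCluster ω v n).1 h.symm⟩
    simp only [hGψ]
    by_cases hω : ω ∈ Nv
    · rw [ind_of_mem (hiff.2 hω), ind_of_mem hω]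
    · rw [ind_of_not_mem (fun h => hω (hiff.1 h)), ind_of_not_mem hω]
  simp only [hF, hG] at key
  rw [setIntegral_rcMeasureW_eq_sum u hq0, setIntegral_rcMeasureW_eq_sum u hq0, setIntegral_rcMeasureW_eq_sum u hq0] at key
  have e1 : ∑ ω, rcMass u q ω * (ind A ω * ind Nv ω * ind Yᶜ ω) = (rcMeasureW u q ∅).real (A ∩ (Nv ∩ Yᶜ)) := by
    rw [rcMeasureW_real_eq_sum_rcMass u hq0]
    refine Finset.sum_congr rfl fun ω _ => ?_
    rw [ind_inter, ind_inter]; ring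
  have e2 : ∑ ω, rcMass u q ω * (ind A ω * ind Yᶜ ω) = (rcMeasureW u q ∅).real (A ∩ Yᶜ) := by
    rw [rcMeasureW_real_eq_sum_rcMass u hq0]
    refine Finset.sum_congr rfl fun ω _ => ?_
    rw [ind_inter]
  have e3 : ∑ ω, rcMass u q ω * (ind Nv ω * ind Yᶜ ω) = (rcMeasureW u q ∅).real (Nv ∩ Yᶜ) := by
    rw [rcMeasureW_real_eq_sum_rcMass u hq0]
    refine Finset.sum_congr rfl fun ω _ => ?_
    rw [ind_inter]
  rw [e1, e2, e3] at key
  calc (rcMeasureW u q ∅).real (A ∩ (Nv ∩ Yᶜ)) * (rcMeasureW u q ∅).real Yᶜ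
      = (rcMeasureW u q ∅).real Yᶜ * (rcMeasureW u q ∅).real (A ∩ (Nv ∩ Yᶜ)) := mul_comm _ _
    _ ≤ (rcMeasureW u q ∅).real (A ∩ Yᶜ) * (rcMeasureW u q ∅).real (Nv ∩ Yᶜ) := key
    _ = (rcMeasureW u q ∅).real (Nv ∩ Yᶜ) * (rcMeasureW u q ∅).real (A ∩ Yᶜ) := mul_comm _ _

end Summit.CriticalPhenomena.PercolationContinuityZ3.Theorems.FK

end
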